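import Mathlib
import HarnessLib
import Summits.ValiantsHypothesis.ValiantsHypothesis.Theorems.EquivariantDialLayersSpecht

/-!
# Equivariant dial, layered face — the floor `m²` on the whole interior (four orbits, four types)

Support for the cell `A = EqHardBiPerm` (item `stmt-ValiantsHypothesis-23702`, draft route `SymmetryDial`) via its
layered leaf `R^lay = IdealWidthSuperpoly` (`idealWidth (biPermSubst m) per_m d` = least number of degree-`d` forms
with `𝔖_m × 𝔖_m`-stable span whose ideal contains `per_m`).  HONEST FRAMING: `VP ≠ VNP` is NOT proved here, nor
`A`, nor `R^lay`, nor any super-polynomial bound: a SIZE-FREE FLOOR CALIBRATION of the leaf by elementary character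
theory of `𝔖_m × 𝔖_m` (isotypic projectors, first orthogonality, minimal degree `m - 1` for `m ≥ 5`) —
textbook-grade, kernel-new only for the leaf; 0 definitions, 0 named facts, 0 summit-currency.  It closes the
gcd-gap of `EquivariantDialLayersCharacters` (`(m/gcd(m,d))²`) / `EquivariantDialLayersSpecht` (`(m-1)²`):
**`m² ≤ idealWidth (biPermSubst m) per_m d` for all `m ≥ 5`, `0 < d < m`**, tight at `d ∈ {1, m - 1}`.
MECHANISM (`0 < d ≤ m - 2`; `d = m - 1` is the coprime column).  Cut forms not vanishing at `J = x_{1,1}`,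
`A = x_{ζ,1}`, `Aᵀ = x_{1,ζ}`, `Z = x_{ζ,ζ}` (`x_{a,b} = (aⁱbʲ)`, `per_m(x_{a,b}) ≠ 0`) give, in `W = span s`,
`v₁ = ∑_g g·p_J` (invariant), `v₂ = ∑_τ (1,τ)(1 - (c,1)) p_A` (column-invariant, killed by the row
(anti)symmetrisers, `v₂(A) = m!(1 - ζ^d) p_A(A) ≠ 0` as the columns of `A` coincide), its mirror `v₃`, and
`v₄ = (1 - (1,c))(1 - (c,1)) p_Z`.  §2 `sq_le_finrank`: the projector of type `χ^λ ⊠ χ^μ` FACTORS through the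
`χ^λ`-weighted row sum, which is `(∑_g χ^λ(g))·v = 0` on a row-fixed `v` unless `λ = (m)` (§1) and vanishes for
`λ = (m)` (resp. `(1ᵐ)`) on a vector killed by the row symmetriser (resp. antisymmetriser); so the `vᵢ` have
non-zero components of four pairwise distinct types `(m)⊠(m)`, `λ⊠(m)`, `(m)⊠μ`, `λ'⊠μ'`
(`λ, μ, λ', μ' ∉ {(m), (1ᵐ)}`; distinct by cross-vanishing `P_{χᵢ} vⱼ = 0 ≠ P_{χⱼ} vⱼ`) and
`dim W ≥ 1 + (m-1) + (m-1) + (m-1)² = m²` (`dim W_χ ≥ f^λ f^μ`, `f ≥ m - 1` off `{(m), (1ᵐ)}`); §3: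
`m² ≤ dim W ≤ card s ≤ r`.
Remark (method ceiling, not a theorem of this file).  For every test point `X` with `per_m(X) ≠ 0` the stabiliser
of `X` acts trivially on the coordinates of the non-zero cells, so the class of types a point evaluation can force
always meets `{𝟙⊠𝟙, 𝟙⊠S, S⊠𝟙, S⊠S}` (`S = χ^{(m-1,1)}`), of total weight `m²`: orbit/evaluation witnesses
certify at most `m²`; more (let alone the `m^c` of `R^lay`) needs non-evaluative (apolar) witnesses.
Reused by import, not restated: `sum_sign_smul_rename_row_eq_zero`/`col`, `card_parts_le_one_of_le_part`,
`parts_eq_replicate_of_le_card`, `sum_boxProd_smul_eq_row`/`col`, `exists_eval_ne_zero_of_mem_idealSpan`,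
`eval_powPoint_perPoly_ne_zero`, `eval_rename_shift_powPoint`, `sq_le_of_hasIdealWidthLE_of_coprime`,
`sum_isotypicProj_apply`, `sum_finrank_range_isotypicProj`, `IsIrrChar.classInner_eq`, `sub_one_le_numStandardTableaux`.
-/

set_option linter.dupNamespace false

namespace Summit.ValiantsHypothesis.ValiantsHypothesis.Theorems.EquivariantDialLayersSquare

open MvPolynomial Matrix Literature.Computability.AlgebraicComplexity
open Literature.RepresentationTheory.FiniteGroups Literature.NumberTheory.DiophantineGeometry
open Summit.ValiantsHypothesis.ValiantsHypothesis.Theorems.EquivariantDialNode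
open Summit.ValiantsHypothesis.ValiantsHypothesis.Theorems.EquivariantDialLayers
open Summit.ValiantsHypothesis.ValiantsHypothesis.Theorems.EquivariantDialLayersCharacters
open Summit.ValiantsHypothesis.ValiantsHypothesis.Theorems.EquivariantDialLayersSpecht
open Summit.ValiantsHypothesis.ValiantsHypothesis.Theorems.OrbitRestorationQPMixingScale.SpechtDim
open Equiv (Perm)

/-! ## §1 Orthogonality to the trivial character -/

/-- **`∑_g χ^μ(g) = 0` unless `μ = (n)`** (`n ≠ 0`): first orthogonality against `χ^{(n)} ≡ 1`.
[cite: SerreLinearRepresentations1977, §2.3 Thm. 3] -/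
theorem sum_spechtCharacter_eq_zero {n : ℕ} (hn : n ≠ 0) (μ : Nat.Partition n) (h : ¬ μ.parts.card ≤ 1) :
    ∑ g : Perm (Fin n), spechtCharacter ℂ μ g = 0 := by
  classical
  have hν : (Nat.Partition.indiscrete n).parts.card ≤ 1 := by simp [Nat.Partition.indiscrete_parts hn]
  have hne : spechtCharacter ℂ μ ≠ spechtCharacter ℂ (Nat.Partition.indiscrete n) := fun e =>
    h (by rw [spechtCharacter_injective e]; exact hν)
  have horth := (isIrrChar_spechtCharacter μ).classInner_eq (isIrrChar_spechtCharacter (Nat.Partition.indiscrete n))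
  rw [if_neg hne, classInner_apply] at horth
  simp_rw [spechtCharacter_eq_one_of_card_parts_le_one _ hν, mul_one] at horth
  exact (mul_eq_zero.1 horth).resolve_left (inv_ne_zero (Nat.cast_ne_zero.2 Fintype.card_ne_zero))

/-! ## §2 Abstract floor: four vectors force `m² ≤ dim V` -/

section Abstract

variable {m : ℕ} {V : Type} [AddCommGroup V] [Module ℂ V] (ρ : Representation ℂ (Perm (Fin m) × Perm (Fin m)) V)

/-- The projector of type `χ^λ ⊠ χ^μ` factors through the `χ^λ`-weighted ROW sum. [folklore] -/
theorem isotypicProj_eq_zero_of_row {χ : Perm (Fin m) × Perm (Fin m) → ℂ} {la mu : Nat.Partition m}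
    (hχt : ∀ t : Perm (Fin m) × Perm (Fin m), χ t = spechtCharacter ℂ la t.1 * spechtCharacter ℂ mu t.2) {v : V}
    (h0 : ∑ g : Perm (Fin m), spechtCharacter ℂ la g • ρ (g⁻¹, 1) v = 0) : isotypicProj ρ χ v = 0 := by
  rw [isotypicProj_apply]; simp_rw [hχt]
  rw [sum_boxProd_smul_eq_row ρ v _ (spechtCharacter ℂ la) (spechtCharacter ℂ mu), h0]; simp

/-- The projector of type `χ^λ ⊠ χ^μ` factors through the `χ^μ`-weighted COLUMN sum. [folklore] -/
theorem isotypicProj_eq_zero_of_col {χ : Perm (Fin m) × Perm (Fin m) → ℂ} {la mu : Nat.Partition m}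
    (hχt : ∀ t : Perm (Fin m) × Perm (Fin m), χ t = spechtCharacter ℂ la t.1 * spechtCharacter ℂ mu t.2) {v : V}
    (h0 : ∑ h : Perm (Fin m), spechtCharacter ℂ mu h • ρ (1, h⁻¹) v = 0) : isotypicProj ρ χ v = 0 := by
  rw [isotypicProj_apply]; simp_rw [hχt]
  rw [sum_boxProd_smul_eq_col ρ v _ (spechtCharacter ℂ la) (spechtCharacter ℂ mu), h0]; simp

variable [FiniteDimensional ℂ V]

/-- A non-zero vector has a non-zero isotypic component of some box-product type `χ = χ^λ ⊠ χ^μ`, and then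
**`f^λ f^μ ≤ dim V_χ`** (`V_χ = range P_χ ∋ P_χ v ≠ 0`, `dim V_χ = χ(1)·(multiplicity)`).
[cite: SerreLinearRepresentations1977, §2.6 Thm. 8] -/
theorem exists_boxProd_isotypicProj_ne_zero {v : V} (hv : v ≠ 0) :
    ∃ χ ∈ (irrChars_finite_holds (Perm (Fin m) × Perm (Fin m))).toFinset, ∃ la mu : Nat.Partition m,
      (∀ t : Perm (Fin m) × Perm (Fin m), χ t = spechtCharacter ℂ la t.1 * spechtCharacter ℂ mu t.2) ∧
        isotypicProj ρ χ v ≠ 0 ∧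
          numStandardTableaux la * numStandardTableaux mu ≤ Module.finrank ℂ ↥(LinearMap.range (isotypicProj ρ χ)) := by
  classical
  have hsum : ∑ χ ∈ (irrChars_finite_holds _).toFinset, isotypicProj ρ χ v ≠ 0 := by
    rw [sum_isotypicProj_apply]; exact hv
  obtain ⟨χ, hχT, hPne⟩ := Finset.exists_ne_zero_of_sum_ne_zero hsum
  have hχ : χ ∈ irrChars (Perm (Fin m) × Perm (Fin m)) := (irrChars_finite_holds _).mem_toFinset.mp hχT
  obtain ⟨ψ, hψ, φ, hφ, hχeq⟩ := exists_eq_boxProd_of_mem_irrChars hχ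
  rw [irrChars_perm_eq] at hψ hφ
  obtain ⟨la, rfl⟩ := hψ
  obtain ⟨mu, rfl⟩ := hφ
  have hχt : ∀ t : Perm (Fin m) × Perm (Fin m), χ t = spechtCharacter ℂ la t.1 * spechtCharacter ℂ mu t.2 :=
    fun t => by rw [hχeq]
  refine ⟨χ, hχT, la, mu, hχt, hPne, ?_⟩
  -- dimension count on `V_χ = range P_χ ∋ P_χ v ≠ 0`
  obtain ⟨W, _, _, _, τ, hτ, hτχ⟩ := hχ
  haveI := hτ
  have hdim := finrank_range_isotypicProj_eq_mul_finrank_intertwiningMap ρ τ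
  rw [hτχ] at hdim
  have hdimN : Module.finrank ℂ ↥(LinearMap.range (isotypicProj ρ χ)) =
      Module.finrank ℂ W * Module.finrank ℂ (Representation.IntertwiningMap τ ρ) := by exact_mod_cast hdim
  have hW : Module.finrank ℂ W = numStandardTableaux la * numStandardTableaux mu := by
    have h1 := Representation.char_one τ
    rw [hτχ, hχt, Prod.fst_one, Prod.snd_one, spechtCharacter_one_eq_numStandardTableaux,
      spechtCharacter_one_eq_numStandardTableaux] at h1
    exact_mod_cast h1.symm
  have hpos : Module.finrank ℂ ↥(ℂ ∙ isotypicProj ρ χ v) ≤ Module.finrank ℂ ↥(LinearMap.range (isotypicProj ρ χ)) :=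
    Submodule.finrank_mono ((Submodule.span_singleton_le_iff_mem _ _).2 (LinearMap.mem_range_self _ _))
  rw [finrank_span_singleton hPne] at hpos
  have hk : 0 < Module.finrank ℂ (Representation.IntertwiningMap τ ρ) :=
    Nat.pos_of_ne_zero fun hk => by rw [hk, mul_zero] at hdimN; omega
  rw [hdimN, ← hW]
  exact Nat.le_mul_of_pos_right _ hk

/-- **Abstract floor `m²`.**  In a finite-dimensional `ℂ[𝔖_m × 𝔖_m]`-module (`m ≥ 5`), an invariant `v₁ ≠ 0`, a
column-invariant `v₂ ≠ 0` killed by the row symmetriser and antisymmetriser, its mirror `v₃`, and a `v₄ ≠ 0` killed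
by all four (anti)symmetrisers have non-zero isotypic components of four distinct types `(m)⊠(m)`, `λ⊠(m)`,
`(m)⊠μ`, `λ'⊠μ'` (`λ, μ, λ', μ' ∉ {(m), (1ᵐ)}`), whence `m² = 1 + 2(m-1) + (m-1)² ≤ dim V`.
[cite: JamesLNM682, 6.6–6.7; SerreLinearRepresentations1977, §2.6 Thm. 8] -/
theorem sq_le_finrank (hm : 5 ≤ m) {v₁ v₂ v₃ v₄ : V} (h1v : v₁ ≠ 0)
    (h1 : ∀ g : Perm (Fin m) × Perm (Fin m), ρ g v₁ = v₁)
    (h2v : v₂ ≠ 0) (h2c : ∀ τ : Perm (Fin m), ρ (1, τ) v₂ = v₂) (h2s : ∑ σ : Perm (Fin m), ρ (σ, 1) v₂ = 0)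
    (h2a : ∑ σ : Perm (Fin m), ((Equiv.Perm.sign σ : ℤ) : ℂ) • ρ (σ, 1) v₂ = 0)
    (h3v : v₃ ≠ 0) (h3r : ∀ σ : Perm (Fin m), ρ (σ, 1) v₃ = v₃) (h3s : ∑ τ : Perm (Fin m), ρ (1, τ) v₃ = 0)
    (h3a : ∑ τ : Perm (Fin m), ((Equiv.Perm.sign τ : ℤ) : ℂ) • ρ (1, τ) v₃ = 0)
    (h4v : v₄ ≠ 0) (h4rs : ∑ σ : Perm (Fin m), ρ (σ, 1) v₄ = 0)
    (h4ra : ∑ σ : Perm (Fin m), ((Equiv.Perm.sign σ : ℤ) : ℂ) • ρ (σ, 1) v₄ = 0)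
    (h4cs : ∑ τ : Perm (Fin m), ρ (1, τ) v₄ = 0)
    (h4ca : ∑ τ : Perm (Fin m), ((Equiv.Perm.sign τ : ℤ) : ℂ) • ρ (1, τ) v₄ = 0) :
    m ^ 2 ≤ Module.finrank ℂ V := by
  classical
  have hm0 : m ≠ 0 := by omega
  have hinv : ∀ f : Perm (Fin m) → V, ∑ g : Perm (Fin m), f g⁻¹ = ∑ g : Perm (Fin m), f g :=
    fun f => Fintype.sum_equiv (Equiv.inv _) _ _ fun _ => rfl
  have hinvs : ∀ f : Perm (Fin m) → V, ∑ g : Perm (Fin m), ((Equiv.Perm.sign g : ℤ) : ℂ) • f g⁻¹ =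
      ∑ g : Perm (Fin m), ((Equiv.Perm.sign g : ℤ) : ℂ) • f g :=
    fun f => Fintype.sum_equiv (Equiv.inv _) _ _ fun g => by rw [Equiv.inv_apply, Equiv.Perm.sign_inv]
  -- the weighted row sum `∑_g χ^λ(g) (g⁻¹,1) v` dies: `λ = (m)` + symmetriser, `λ = (1ᵐ)` + antisymmetriser,
  -- `λ ≠ (m)` + row-fixed (§1); then the column mirrors
  have R1 : ∀ {la : Nat.Partition m} {v : V}, la.parts.card ≤ 1 → ∑ σ : Perm (Fin m), ρ (σ, 1) v = 0 →
      ∑ g : Perm (Fin m), spechtCharacter ℂ la g • ρ (g⁻¹, 1) v = 0 := @fun la v hla hs => by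
    simp_rw [spechtCharacter_eq_one_of_card_parts_le_one la hla, one_smul]; rw [hinv (fun g => ρ (g, 1) v), hs]
  have R2 : ∀ {la : Nat.Partition m} {v : V}, la.parts = Multiset.replicate m 1 →
      ∑ σ : Perm (Fin m), ((Equiv.Perm.sign σ : ℤ) : ℂ) • ρ (σ, 1) v = 0 →
      ∑ g : Perm (Fin m), spechtCharacter ℂ la g • ρ (g⁻¹, 1) v = 0 := @fun la v hla ha => by
    simp_rw [spechtCharacter_of_parts_eq_replicate_one la hla]; rw [hinvs (fun g => ρ (g, 1) v), ha]
  have R3 : ∀ {la : Nat.Partition m} {v : V}, ¬ la.parts.card ≤ 1 → (∀ σ : Perm (Fin m), ρ (σ, 1) v = v) →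
      ∑ g : Perm (Fin m), spechtCharacter ℂ la g • ρ (g⁻¹, 1) v = 0 := @fun la v hla hfix => by
    simp_rw [show ∀ g : Perm (Fin m), ρ (g⁻¹, 1) v = v from fun g => hfix g⁻¹, ← Finset.sum_smul,
      sum_spechtCharacter_eq_zero hm0 la hla, zero_smul]
  have C1 : ∀ {mu : Nat.Partition m} {v : V}, mu.parts.card ≤ 1 → ∑ τ : Perm (Fin m), ρ (1, τ) v = 0 →
      ∑ h : Perm (Fin m), spechtCharacter ℂ mu h • ρ (1, h⁻¹) v = 0 := @fun mu v hmu hs => by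
    simp_rw [spechtCharacter_eq_one_of_card_parts_le_one mu hmu, one_smul]; rw [hinv (fun g => ρ (1, g) v), hs]
  have C2 : ∀ {mu : Nat.Partition m} {v : V}, mu.parts = Multiset.replicate m 1 →
      ∑ τ : Perm (Fin m), ((Equiv.Perm.sign τ : ℤ) : ℂ) • ρ (1, τ) v = 0 →
      ∑ h : Perm (Fin m), spechtCharacter ℂ mu h • ρ (1, h⁻¹) v = 0 := @fun mu v hmu ha => by
    simp_rw [spechtCharacter_of_parts_eq_replicate_one mu hmu]; rw [hinvs (fun g => ρ (1, g) v), ha]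
  have C3 : ∀ {mu : Nat.Partition m} {v : V}, ¬ mu.parts.card ≤ 1 → (∀ τ : Perm (Fin m), ρ (1, τ) v = v) →
      ∑ h : Perm (Fin m), spechtCharacter ℂ mu h • ρ (1, h⁻¹) v = 0 := @fun mu v hmu hfix => by
    simp_rw [show ∀ g : Perm (Fin m), ρ (1, g⁻¹) v = v from fun g => hfix g⁻¹, ← Finset.sum_smul,
      sum_spechtCharacter_eq_zero hm0 mu hmu, zero_smul]
  -- the four non-zero isotypic components, their types, and `dim V_χ ≥ f^λ f^μ`
  obtain ⟨χ₁, hT₁, la₁, mu₁, hχ₁, hP₁, hD₁⟩ := exists_boxProd_isotypicProj_ne_zero ρ h1v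
  obtain ⟨χ₂, hT₂, la₂, mu₂, hχ₂, hP₂, hD₂⟩ := exists_boxProd_isotypicProj_ne_zero ρ h2v
  obtain ⟨χ₃, hT₃, la₃, mu₃, hχ₃, hP₃, hD₃⟩ := exists_boxProd_isotypicProj_ne_zero ρ h3v
  obtain ⟨χ₄, hT₄, la₄, mu₄, hχ₄, hP₄, hD₄⟩ := exists_boxProd_isotypicProj_ne_zero ρ h4v
  have hla₁ : la₁.parts.card ≤ 1 :=
    not_not.1 fun h => hP₁ (isotypicProj_eq_zero_of_row ρ hχ₁ (R3 h fun σ => h1 (σ, 1)))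
  have hmu₁ : mu₁.parts.card ≤ 1 :=
    not_not.1 fun h => hP₁ (isotypicProj_eq_zero_of_col ρ hχ₁ (C3 h fun τ => h1 (1, τ)))
  have hmu₂ : mu₂.parts.card ≤ 1 := not_not.1 fun h => hP₂ (isotypicProj_eq_zero_of_col ρ hχ₂ (C3 h h2c))
  have hla₂ : ¬ la₂.parts.card ≤ 1 := fun h => hP₂ (isotypicProj_eq_zero_of_row ρ hχ₂ (R1 h h2s))
  have hla₂' : la₂.parts ≠ Multiset.replicate m 1 := fun h => hP₂ (isotypicProj_eq_zero_of_row ρ hχ₂ (R2 h h2a))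
  have hla₃ : la₃.parts.card ≤ 1 := not_not.1 fun h => hP₃ (isotypicProj_eq_zero_of_row ρ hχ₃ (R3 h h3r))
  have hmu₃ : ¬ mu₃.parts.card ≤ 1 := fun h => hP₃ (isotypicProj_eq_zero_of_col ρ hχ₃ (C1 h h3s))
  have hmu₃' : mu₃.parts ≠ Multiset.replicate m 1 := fun h => hP₃ (isotypicProj_eq_zero_of_col ρ hχ₃ (C2 h h3a))
  have hla₄ : ¬ la₄.parts.card ≤ 1 := fun h => hP₄ (isotypicProj_eq_zero_of_row ρ hχ₄ (R1 h h4rs))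
  have hla₄' : la₄.parts ≠ Multiset.replicate m 1 := fun h => hP₄ (isotypicProj_eq_zero_of_row ρ hχ₄ (R2 h h4ra))
  have hmu₄ : ¬ mu₄.parts.card ≤ 1 := fun h => hP₄ (isotypicProj_eq_zero_of_col ρ hχ₄ (C1 h h4cs))
  have hmu₄' : mu₄.parts ≠ Multiset.replicate m 1 := fun h => hP₄ (isotypicProj_eq_zero_of_col ρ hχ₄ (C2 h h4ca))
  -- pairwise distinct, by cross-vanishing `P_{χ_i} v_j = 0 ≠ P_{χ_j} v_j`
  have h12 : χ₁ ≠ χ₂ := fun e => hP₂ (by rw [← e]; exact isotypicProj_eq_zero_of_row ρ hχ₁ (R1 hla₁ h2s))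
  have h13 : χ₁ ≠ χ₃ := fun e => hP₃ (by rw [← e]; exact isotypicProj_eq_zero_of_col ρ hχ₁ (C1 hmu₁ h3s))
  have h14 : χ₁ ≠ χ₄ := fun e => hP₄ (by rw [← e]; exact isotypicProj_eq_zero_of_row ρ hχ₁ (R1 hla₁ h4rs))
  have h23 : χ₂ ≠ χ₃ := fun e => hP₃ (by rw [← e]; exact isotypicProj_eq_zero_of_row ρ hχ₂ (R3 hla₂ h3r))
  have h24 : χ₂ ≠ χ₄ := fun e => hP₄ (by rw [← e]; exact isotypicProj_eq_zero_of_col ρ hχ₂ (C1 hmu₂ h4cs))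
  have h34 : χ₃ ≠ χ₄ := fun e => hP₄ (by rw [← e]; exact isotypicProj_eq_zero_of_row ρ hχ₃ (R1 hla₃ h4rs))
  -- minimal degrees: `f ≥ 1`, and `f ≥ m - 1` off `{(m), (1ᵐ)}`; the four blocks add up to `m²`
  have hf : ∀ nu : Nat.Partition m, ¬ nu.parts.card ≤ 1 → nu.parts ≠ Multiset.replicate m 1 →
      m - 1 ≤ numStandardTableaux nu := fun nu h h' => sub_one_le_numStandardTableaux hm nu
    (fun a ha => by by_contra hc; exact h (card_parts_le_one_of_le_part nu ha (by omega)))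
    (by by_contra hc; exact h' (parts_eq_replicate_of_le_card nu (by omega)))
  have hf₁ : ∀ nu : Nat.Partition m, 1 ≤ numStandardTableaux nu := fun nu => numStandardTableaux_pos_holds nu
  have hd₁ := (Nat.mul_le_mul (hf₁ la₁) (hf₁ mu₁)).trans hD₁
  have hd₂ := (Nat.mul_le_mul (hf la₂ hla₂ hla₂') (hf₁ mu₂)).trans hD₂
  have hd₃ := (Nat.mul_le_mul (hf₁ la₃) (hf mu₃ hmu₃ hmu₃')).trans hD₃
  have hd₄ := (Nat.mul_le_mul (hf la₄ hla₄ hla₄') (hf mu₄ hmu₄ hmu₄')).trans hD₄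
  have hsub : ({χ₁, χ₂, χ₃, χ₄} : Finset (Perm (Fin m) × Perm (Fin m) → ℂ)) ⊆
      (irrChars_finite_holds (Perm (Fin m) × Perm (Fin m))).toFinset := by
    intro χ hχ
    simp only [Finset.mem_insert, Finset.mem_singleton] at hχ
    rcases hχ with rfl | rfl | rfl | rfl <;> assumption
  have htot : 1 * 1 + ((m - 1) * 1 + (1 * (m - 1) + (m - 1) * (m - 1))) ≤ Module.finrank ℂ V := by
    rw [← sum_finrank_range_isotypicProj ρ]
    refine le_trans ?_ (Finset.sum_le_sum_of_subset_of_nonneg hsub fun _ _ _ => Nat.zero_le _)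
    rw [Finset.sum_insert (by simp [h12, h13, h14]), Finset.sum_insert (by simp [h23, h24]), Finset.sum_pair h34]
    exact Nat.add_le_add hd₁ (Nat.add_le_add hd₂ (Nat.add_le_add hd₃ hd₄))
  obtain ⟨k, rfl⟩ : ∃ k, m = k + 1 := ⟨m - 1, by omega⟩
  rw [Nat.add_sub_cancel] at htot
  calc (k + 1) ^ 2 = 1 * 1 + (k * 1 + (1 * k + k * k)) := by ring
    _ ≤ Module.finrank ℂ V := htot

end Abstract

/-! ## §3 The leaf: `m² ≤ idealWidth (biPermSubst m) per_m d` on the whole interior -/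

/-- **`m² ≤ r` for every window-stable degree-`d` cut of `per_m` by `r` forms**, `0 < d ≤ m - 2`, `m ≥ 5`: the test
vectors `v₁ = ∑_g g·p_J`, `v₂ = ∑_τ (1,τ)(1 - (c,1)) p_A`, `v₃ = ∑_σ (σ,1)(1 - (1,c)) p_{Aᵀ}`,
`v₄ = (1 - (1,c))(1 - (c,1)) p_Z` of `span s` feed `sq_le_finrank`. [folklore] -/
theorem sq_le_of_hasIdealWidthLE {m d r : ℕ} (hm : 5 ≤ m) (hd : 0 < d) (hdm : d + 2 ≤ m)
    (h : HasIdealWidthLE (biPermSubst m) (perPoly (Fin m) ℂ) d r) : m ^ 2 ≤ r := by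
  classical
  haveI : NeZero m := ⟨by omega⟩
  obtain ⟨s, hcard, hhom, hstab, hmem⟩ := h
  set W : Submodule ℂ (MvPolynomial (Fin m × Fin m) ℂ) :=
    Submodule.span ℂ (s : Set (MvPolynomial (Fin m × Fin m) ℂ))
  haveI : FiniteDimensional ℂ W := FiniteDimensional.span_finset ℂ s
  -- `W = span s` is a `𝔖_m × 𝔖_m`-module (window-stability) of degree-`d` forms
  have hW : ∀ (g : Perm (Fin m) × Perm (Fin m)) (w : MvPolynomial (Fin m × Fin m) ℂ),
      w ∈ W → (rename (Equiv.prodCongr g.1 g.2)).toLinearMap w ∈ W := fun g w hw =>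
    (Submodule.map_span_le _ _ _).2 (fun p hp => rename_prodCongr_mem_span hstab g.1 g.2 hp) (Submodule.mem_map_of_mem hw)
  have hcomp : ∀ a b : Perm (Fin m) × Perm (Fin m), (⇑(Equiv.prodCongr a.1 a.2) ∘ ⇑(Equiv.prodCongr b.1 b.2) :
      Fin m × Fin m → Fin m × Fin m) = ⇑(Equiv.prodCongr (a * b).1 (a * b).2) :=
    fun a b => funext fun ⟨i, j⟩ => rfl
  have hid : (⇑(Equiv.prodCongr (1 : Perm (Fin m) × Perm (Fin m)).1 (1 : Perm (Fin m) × Perm (Fin m)).2) :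
      Fin m × Fin m → Fin m × Fin m) = id := funext fun ⟨i, j⟩ => rfl
  let ρ : Representation ℂ (Perm (Fin m) × Perm (Fin m)) W :=
    { toFun := fun g => ((rename (Equiv.prodCongr g.1 g.2)).toLinearMap).restrict (hW g)
      map_one' := LinearMap.ext fun w => Subtype.ext (by
        simp only [LinearMap.coe_restrict_apply, AlgHom.toLinearMap_apply, Module.End.one_apply, hid, rename_id_apply])
      map_mul' := fun a b => LinearMap.ext fun w => Subtype.ext (by
        simp only [LinearMap.coe_restrict_apply, AlgHom.toLinearMap_apply, Module.End.mul_apply, rename_rename, hcomp]) }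
  have hρ : ∀ (g : Perm (Fin m) × Perm (Fin m)) (x : W), ((ρ g x : W) : MvPolynomial (Fin m × Fin m) ℂ) =
      rename (Equiv.prodCongr g.1 g.2) (x : MvPolynomial (Fin m × Fin m) ℂ) := fun _ _ => rfl
  have hdeg : ∀ w : W, ((w : W) : MvPolynomial (Fin m × Fin m) ℂ).totalDegree + 2 ≤ m := fun w =>
    (Nat.add_le_add_right ((mem_homogeneousSubmodule d _).1 ((Submodule.span_le.2 fun p hp =>
      (mem_homogeneousSubmodule d p).2 (hhom p hp) : W ≤ homogeneousSubmodule (Fin m × Fin m) ℂ d)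
        w.2)).totalDegree_le 2).trans hdm
  -- generic identities in `W`: antisymmetrisers vanish, the two actions commute, orbit sums are fixed, `∑_σ σ(1-a) = 0`
  have hsignR : ∀ w : W, ∑ σ : Perm (Fin m), ((Equiv.Perm.sign σ : ℤ) : ℂ) • ρ (σ, 1) w = 0 := fun w => by
    apply Subtype.coe_injective
    simp only [Submodule.coe_sum, Submodule.coe_smul, Submodule.coe_zero, hρ]; exact sum_sign_smul_rename_row_eq_zero (hdeg w)
  have hsignC : ∀ w : W, ∑ τ : Perm (Fin m), ((Equiv.Perm.sign τ : ℤ) : ℂ) • ρ (1, τ) w = 0 := fun w => by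
    apply Subtype.coe_injective
    simp only [Submodule.coe_sum, Submodule.coe_smul, Submodule.coe_zero, hρ]; exact sum_sign_smul_rename_col_eq_zero (hdeg w)
  have hmul : ∀ (a b : Perm (Fin m) × Perm (Fin m)) (w : W), ρ a (ρ b w) = ρ (a * b) w := fun a b w => by
    rw [map_mul, Module.End.mul_apply]
  have hcomm : ∀ (σ τ : Perm (Fin m)) (w : W), ρ (σ, 1) (ρ (1, τ) w) = ρ (1, τ) (ρ (σ, 1) w) := fun σ τ w => by
    rw [hmul, hmul, Prod.mk_mul_mk, Prod.mk_mul_mk, one_mul, mul_one, one_mul, mul_one]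
  have hfixR : ∀ (σ : Perm (Fin m)) (y : W),
      ρ (σ, 1) (∑ σ' : Perm (Fin m), ρ (σ', 1) y) = ∑ σ' : Perm (Fin m), ρ (σ', 1) y := fun σ y => by
    rw [map_sum]
    exact Fintype.sum_equiv (Equiv.mulLeft σ) _ _ fun σ' => by rw [hmul, Prod.mk_mul_mk, one_mul, Equiv.coe_mulLeft]
  have hfixC : ∀ (τ : Perm (Fin m)) (y : W),
      ρ (1, τ) (∑ τ' : Perm (Fin m), ρ (1, τ') y) = ∑ τ' : Perm (Fin m), ρ (1, τ') y := fun τ y => by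
    rw [map_sum]
    exact Fintype.sum_equiv (Equiv.mulLeft τ) _ _ fun τ' => by rw [hmul, Prod.mk_mul_mk, one_mul, Equiv.coe_mulLeft]
  have hRC : ∀ y : W, ∑ σ : Perm (Fin m), ρ (σ, 1) (∑ τ : Perm (Fin m), ρ (1, τ) y) =
      ∑ τ : Perm (Fin m), ρ (1, τ) (∑ σ : Perm (Fin m), ρ (σ, 1) y) := fun y => by
    simp_rw [map_sum, hcomm _ _ y]
    exact Finset.sum_comm
  have hkillR : ∀ (a : Perm (Fin m)) (w : W), ∑ σ : Perm (Fin m), ρ (σ, 1) (w - ρ (a, 1) w) = 0 := fun a w => by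
    simp only [map_sub, Finset.sum_sub_distrib, hmul, Prod.mk_mul_mk, mul_one]
    exact sub_eq_zero.2 (Fintype.sum_equiv (Equiv.mulRight a⁻¹) _ _ fun σ => by simp)
  have hkillC : ∀ (a : Perm (Fin m)) (w : W), ∑ τ : Perm (Fin m), ρ (1, τ) (w - ρ (1, a) w) = 0 := fun a w => by
    simp only [map_sub, Finset.sum_sub_distrib, hmul, Prod.mk_mul_mk, mul_one]
    exact sub_eq_zero.2 (Fintype.sum_equiv (Equiv.mulRight a⁻¹) _ _ fun τ => by simp)
  -- the test points `x_{a,b}`, `a, b ∈ {1, ζ}`, cut forms `pᵢ ∈ s` not vanishing there, and the `m`-cycle `c`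
  obtain ⟨ζ, hζ⟩ : ∃ ζ : ℂ, IsPrimitiveRoot ζ m := ⟨_, Complex.isPrimitiveRoot_exp m (by omega)⟩
  have hζm : ζ ^ m = 1 := hζ.pow_eq_one
  have h1m : (1 : ℂ) ^ m = 1 := one_pow m
  have hζ0 : ζ ≠ 0 := ne_zero_of_pow_eq_one' hζm
  have hζd : 1 - ζ ^ d ≠ 0 := sub_ne_zero.2 (hζ.pow_ne_one_of_pos_of_lt (by omega) (by omega)).symm
  have hG : (Fintype.card (Perm (Fin m)) : ℂ) ≠ 0 := Nat.cast_ne_zero.2 Fintype.card_ne_zero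
  have hpt : ∀ {a b : ℂ}, a ≠ 0 → b ≠ 0 → ∃ p ∈ (s : Set (MvPolynomial (Fin m × Fin m) ℂ)),
      eval (fun ij : Fin m × Fin m => a ^ (ij.1 : ℕ) * b ^ (ij.2 : ℕ)) p ≠ 0 := fun ha hb =>
    exists_eval_ne_zero_of_mem_idealSpan hmem (eval_powPoint_perPoly_ne_zero m ha hb)
  obtain ⟨p₁, hp₁, hp₁x⟩ := hpt one_ne_zero one_ne_zero
  obtain ⟨p₂, hp₂, hp₂x⟩ := hpt hζ0 one_ne_zero
  obtain ⟨p₃, hp₃, hp₃x⟩ := hpt one_ne_zero hζ0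
  obtain ⟨p₄, hp₄, hp₄x⟩ := hpt hζ0 hζ0
  set xJ : Fin m × Fin m → ℂ := fun ij => (1 : ℂ) ^ (ij.1 : ℕ) * (1 : ℂ) ^ (ij.2 : ℕ) with hxJ
  set xA : Fin m × Fin m → ℂ := fun ij => ζ ^ (ij.1 : ℕ) * (1 : ℂ) ^ (ij.2 : ℕ) with hxA
  set xB : Fin m × Fin m → ℂ := fun ij => (1 : ℂ) ^ (ij.1 : ℕ) * ζ ^ (ij.2 : ℕ) with hxB
  set xZ : Fin m × Fin m → ℂ := fun ij => ζ ^ (ij.1 : ℕ) * ζ ^ (ij.2 : ℕ) with hxZ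
  set u : Fin m := ⟨1, by omega⟩ with hudef
  set c : Perm (Fin m) := Equiv.addRight u with hcdef
  have h01 : (1 : Perm (Fin m)) = Equiv.addRight (⟨0, by omega⟩ : Fin m) := Equiv.ext fun i => Fin.ext (by simp)
  -- `v₁ = ∑_g g·p_J`: invariant, `v₁(J) = (m!)² p_J(J) ≠ 0` (`J` is fixed by the window)
  set w₁ : W := ⟨p₁, Submodule.subset_span hp₁⟩
  have h1 : ∀ g : Perm (Fin m) × Perm (Fin m), ρ g (∑ g' : Perm (Fin m) × Perm (Fin m), ρ g' w₁) =
      ∑ g' : Perm (Fin m) × Perm (Fin m), ρ g' w₁ := fun g => by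
    rw [map_sum]; exact Fintype.sum_equiv (Equiv.mulLeft g) _ _ fun g' => by rw [hmul, Equiv.coe_mulLeft]
  have hJ : ∀ e : Fin m × Fin m → Fin m × Fin m, xJ ∘ e = xJ := fun e => funext fun ij => by simp [hxJ]
  have hv₁x : eval xJ (((∑ g : Perm (Fin m) × Perm (Fin m), ρ g w₁ : W)) : MvPolynomial (Fin m × Fin m) ℂ) =
      (Fintype.card (Perm (Fin m) × Perm (Fin m)) : ℂ) * eval xJ (w₁ : MvPolynomial (Fin m × Fin m) ℂ) := by
    rw [Submodule.coe_sum, map_sum]; simp_rw [hρ, eval_rename, hJ]; rw [Finset.sum_const, Finset.card_univ, nsmul_eq_mul]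
  have h1v : ∑ g : Perm (Fin m) × Perm (Fin m), ρ g w₁ ≠ 0 := fun h0 => by
    rw [h0, Submodule.coe_zero, map_zero] at hv₁x
    exact mul_ne_zero (Nat.cast_ne_zero.2 Fintype.card_ne_zero) hp₁x hv₁x.symm
  -- `v₂ = ∑_τ (1,τ) y₂`, `y₂ = (1 - (c,1)) p_A`: column-invariant, row symmetriser `0`, `v₂(A) = m!(1-ζ^d)p_A(A)`
  set w₂ : W := ⟨p₂, Submodule.subset_span hp₂⟩
  set y₂ : W := w₂ - ρ (c, 1) w₂
  have hy₂s : ∑ σ : Perm (Fin m), ρ (σ, 1) y₂ = 0 := hkillR c w₂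
  have h2s : ∑ σ : Perm (Fin m), ρ (σ, 1) (∑ τ : Perm (Fin m), ρ (1, τ) y₂) = 0 := by rw [hRC, hy₂s]; simp
  have hA : ∀ τ : Perm (Fin m), xA ∘ ⇑(Equiv.prodCongr (1 : Perm (Fin m)) τ) = xA := fun τ =>
    funext fun ij => by simp [hxA]
  have hy₂x : eval xA ((y₂ : W) : MvPolynomial (Fin m × Fin m) ℂ) = (1 - ζ ^ d) * eval xA p₂ := by
    show eval xA (p₂ - rename (Equiv.prodCongr c (1 : Perm (Fin m))) p₂) = _
    rw [h01]; simp only [map_sub, hcdef, hudef, hxA, eval_rename_shift_powPoint hζm h1m (hhom p₂ hp₂), pow_zero,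
      pow_one, mul_one]; ring
  have hv₂x : eval xA (((∑ τ : Perm (Fin m), ρ (1, τ) y₂ : W)) : MvPolynomial (Fin m × Fin m) ℂ) =
      (Fintype.card (Perm (Fin m)) : ℂ) * ((1 - ζ ^ d) * eval xA p₂) := by
    rw [Submodule.coe_sum, map_sum]; simp_rw [hρ, eval_rename, hA, hy₂x]; rw [Finset.sum_const, Finset.card_univ, nsmul_eq_mul]
  have h2v : ∑ τ : Perm (Fin m), ρ (1, τ) y₂ ≠ 0 := fun h0 => by
    rw [h0, Submodule.coe_zero, map_zero] at hv₂x; exact mul_ne_zero hG (mul_ne_zero hζd hp₂x) hv₂x.symm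
  -- `v₃ = ∑_σ (σ,1) y₃`, `y₃ = (1 - (1,c)) p_{Aᵀ}`: the mirror image
  set w₃ : W := ⟨p₃, Submodule.subset_span hp₃⟩
  set y₃ : W := w₃ - ρ (1, c) w₃
  have hy₃s : ∑ τ : Perm (Fin m), ρ (1, τ) y₃ = 0 := hkillC c w₃
  have h3s : ∑ τ : Perm (Fin m), ρ (1, τ) (∑ σ : Perm (Fin m), ρ (σ, 1) y₃) = 0 := by rw [← hRC, hy₃s]; simp
  have hB : ∀ σ : Perm (Fin m), xB ∘ ⇑(Equiv.prodCongr σ (1 : Perm (Fin m))) = xB := fun σ =>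
    funext fun ij => by simp [hxB]
  have hy₃x : eval xB ((y₃ : W) : MvPolynomial (Fin m × Fin m) ℂ) = (1 - ζ ^ d) * eval xB p₃ := by
    show eval xB (p₃ - rename (Equiv.prodCongr (1 : Perm (Fin m)) c) p₃) = _
    rw [h01]; simp only [map_sub, hcdef, hudef, hxB, eval_rename_shift_powPoint h1m hζm (hhom p₃ hp₃), pow_zero,
      pow_one, one_mul]; ring
  have hv₃x : eval xB (((∑ σ : Perm (Fin m), ρ (σ, 1) y₃ : W)) : MvPolynomial (Fin m × Fin m) ℂ) =
      (Fintype.card (Perm (Fin m)) : ℂ) * ((1 - ζ ^ d) * eval xB p₃) := by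
    rw [Submodule.coe_sum, map_sum]; simp_rw [hρ, eval_rename, hB, hy₃x]; rw [Finset.sum_const, Finset.card_univ, nsmul_eq_mul]
  have h3v : ∑ σ : Perm (Fin m), ρ (σ, 1) y₃ ≠ 0 := fun h0 => by
    rw [h0, Submodule.coe_zero, map_zero] at hv₃x; exact mul_ne_zero hG (mul_ne_zero hζd hp₃x) hv₃x.symm
  -- `v₄ = (1 - (1,c)) y₄`, `y₄ = (1 - (c,1)) p_Z` (`EquivariantDialLayersSpecht`): `v₄(Z) = (1-ζ^d)² p_Z(Z) ≠ 0`
  set w₄ : W := ⟨p₄, Submodule.subset_span hp₄⟩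
  set y₄ : W := w₄ - ρ (c, 1) w₄
  have hv₄coe : ((y₄ - ρ (1, c) y₄ : W) : MvPolynomial (Fin m × Fin m) ℂ) =
      p₄ - rename (Equiv.prodCongr c (1 : Perm (Fin m))) p₄ -
        (rename (Equiv.prodCongr (1 : Perm (Fin m)) c) p₄ - rename (Equiv.prodCongr c c) p₄) := by
    show ((w₄ - ρ (c, 1) w₄ - ρ (1, c) (w₄ - ρ (c, 1) w₄) : W) : MvPolynomial (Fin m × Fin m) ℂ) = _
    rw [map_sub, hmul, Prod.mk_mul_mk, one_mul, mul_one]; rfl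
  have hv₄x : eval xZ ((y₄ - ρ (1, c) y₄ : W) : MvPolynomial (Fin m × Fin m) ℂ) = (1 - ζ ^ d) ^ 2 * eval xZ p₄ := by
    rw [hv₄coe, h01]; simp only [map_sub, hcdef, hudef, hxZ, eval_rename_shift_powPoint hζm hζm (hhom p₄ hp₄),
      pow_zero, pow_one, mul_one, one_mul]; ring
  have h4v : y₄ - ρ (1, c) y₄ ≠ 0 := fun h0 => by
    rw [h0, Submodule.coe_zero, map_zero] at hv₄x; exact mul_ne_zero (pow_ne_zero 2 hζd) hp₄x hv₄x.symm
  have hy₄s : ∑ σ : Perm (Fin m), ρ (σ, 1) y₄ = 0 := hkillR c w₄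
  have h4rs : ∑ σ : Perm (Fin m), ρ (σ, 1) (y₄ - ρ (1, c) y₄) = 0 := by
    simp only [map_sub, Finset.sum_sub_distrib, hy₄s, zero_sub, neg_eq_zero]
    simp_rw [hcomm _ c y₄]; rw [← map_sum, hy₄s, map_zero]
  calc m ^ 2 ≤ Module.finrank ℂ W :=
        sq_le_finrank ρ hm h1v h1 h2v (fun τ => hfixC τ y₂) h2s (hsignR _) h3v (fun σ => hfixR σ y₃) h3s (hsignC _)
          h4v h4rs (hsignR _) (hkillC c y₄) (hsignC _)
    _ ≤ s.card := finrank_span_finset_le_card s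
    _ ≤ r := hcard

/-- **`m² ≤ idealWidth (biPermSubst m) per_m d` for `m ≥ 5` and every `0 < d < m`** (wherever a window-stable
degree-`d` cut exists): `d ≤ m - 2` by `sq_le_of_hasIdealWidthLE`, the coprime column `d = m - 1` by
`sq_le_of_hasIdealWidthLE_of_coprime`.  Supersedes the record floor `max ((m/gcd(m,d))², (m-1)²)`; tight at
`d = 1` and `d = m - 1`. -/
theorem sq_le_idealWidth {m d : ℕ} (hm : 5 ≤ m) (hd : 0 < d) (hdm : d < m)
    (hne : ∃ r, HasIdealWidthLE (biPermSubst m) (perPoly (Fin m) ℂ) d r) :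
    m ^ 2 ≤ idealWidth (biPermSubst m) (perPoly (Fin m) ℂ) d := by
  obtain ⟨r, hr⟩ := hne
  unfold idealWidth
  refine le_csInf ⟨r, hr⟩ fun r' hr' => ?_
  rcases Nat.lt_or_ge (d + 1) m with hlt | hge
  · exact sq_le_of_hasIdealWidthLE hm hd (by omega) hr'
  · have hcop : Nat.Coprime m d := by
      rw [show d = m - 1 by omega]
      exact (Nat.coprime_self_sub_right (by omega)).2 (Nat.coprime_one_right _)
    exact sq_le_of_hasIdealWidthLE_of_coprime (by omega) hcop hr'

end Summit.ValiantsHypothesis.ValiantsHypothesis.Theorems.EquivariantDialLayersSquare
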